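import Literature.AnabelianGeometry.SemiGraphs.TemperedQuasiGeometric
import HarnessLib

/-!
# Definition 3.8, the COMPATIBLE reading (additive companion; finding t2g2-F1)

Mochizuki, *Semi-graphs of anabelioids*, Publ. RIMS **42** (2006), §3, Definition 3.8, manuscript
p. 42 [cite: MochizukiSemiAnbd2006, Def 3.8 p.42]: "Any maximal compact subgroup `K₁ ⊆ Π₁`
(respectively, nontrivial intersection `K₁ ∩ H₁` of two distinct maximal compact subgroups
`K₁, H₁ ⊆ Π₁`) maps surjectively to an open subgroup of some maximal compact subgroup `K₂ ⊆ Π₂`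
(respectively, of some nontrivial intersection `K₂ ∩ H₂` of two distinct maximal compact subgroups
`K₂, H₂ ⊆ Π₂`)."  The tree's `IsQuasiGeometric` (FROZEN) renders this LITERALLY: the pair `K₂, H₂`
of the "respectively" clause is not tied to the images of `K₁`, `H₁`.  Finding t2g2-F1
(abc-iut-L3-t2, 2026-08-25): under the literal reading the "fold" homomorphism
`Π_{v₁} *_{Π_e} Π_{v₂} → Π_w ⊂ π₁^temp(H)` (two copies of one vertex glued along one branch, folded
onto that vertex of `H = (w —e′— w″)`) is quasi-geometric but is induced by NO morphism of
semi-graphs, against the bijection asserted by Cor. 3.9.  This ADDITIVE file records the compatible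
reading — presumably the intended one — as a separate predicate, so that consumers can name it; it
changes no frozen statement and takes no side on which reading the cell adopts (ruling pending).
-/

namespace Literature.AnabelianGeometry.SemiGraphs

universe u

variable {G₁ : Type u} [Group G₁] [TopologicalSpace G₁] {G₂ : Type u} [Group G₂]
  [TopologicalSpace G₂]

/-- **Definition 3.8, compatible reading** ([SemiAnbd] p. 42, the "respectively" clause read
pairwise): `φ` is quasi-geometric AND any two distinct maximal compact subgroups `K₁ ≠ H₁` of `Π₁`
with nontrivial intersection are carried INTO two distinct maximal compact subgroups `K₂ ≠ H₂` of
`Π₂` (`φ(K₁) ⊆ K₂`, `φ(H₁) ⊆ H₂`).  Additive companion of the frozen literal `IsQuasiGeometric`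
(finding t2g2-F1: the literal reading admits "fold" homomorphisms induced by no morphism of
semi-graphs). [cite: MochizukiSemiAnbd2006, Def 3.8 p.42] -/
@[mk_iff] structure IsCompatiblyQuasiGeometric (φ : G₁ →ₜ* G₂) : Prop where
  /-- the literal Definition 3.8 -/
  isQuasiGeometric : IsQuasiGeometric φ
  /-- distinct maximal compact subgroups meeting nontrivially go into distinct maximal compact
  subgroups -/
  compat : ∀ K₁ H₁ : Subgroup G₁, IsMaximalCompactSubgroup K₁ → IsMaximalCompactSubgroup H₁ →
    K₁ ≠ H₁ → K₁ ⊓ H₁ ≠ ⊥ → ∃ K₂ H₂ : Subgroup G₂, IsMaximalCompactSubgroup K₂ ∧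
      IsMaximalCompactSubgroup H₂ ∧ K₂ ≠ H₂ ∧ K₁.map φ.toMonoidHom ≤ K₂ ∧ H₁.map φ.toMonoidHom ≤ H₂

/-- Transport of a subgroup along an isomorphism of topological groups preserves compactness
(local copy of the private lemma of `TemperedQuasiGeometric`). [folklore] -/
private theorem isCompact_map_iff' (e : G₁ ≃ₜ* G₂) (K : Subgroup G₁) :
    IsCompact ((K.map e.toMonoidHom : Subgroup G₂) : Set G₂) ↔ IsCompact (K : Set G₁) := by
  have : ((K.map e.toMonoidHom : Subgroup G₂) : Set G₂) = e.toHomeomorph '' (K : Set G₁) := by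
    ext; simp
  rw [this]
  exact e.toHomeomorph.isCompact_image

/-- An isomorphism of topological groups carries maximal compact subgroups to maximal compact
subgroups (local copy of the private lemma of `TemperedQuasiGeometric`). [folklore] -/
private theorem isMaximalCompactSubgroup_map' (e : G₁ ≃ₜ* G₂) {K : Subgroup G₁}
    (hK : IsMaximalCompactSubgroup K) : IsMaximalCompactSubgroup (K.map e.toMonoidHom) := by
  refine ⟨(isCompact_map_iff' e K).mpr hK.1, fun K' hK' hle => ?_⟩
  have hK'c : IsCompact ((K'.map e.symm.toMonoidHom : Subgroup G₁) : Set G₁) :=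
    (isCompact_map_iff' e.symm K').mpr hK'
  have hle' : K ≤ K'.map e.symm.toMonoidHom := fun x hx =>
    ⟨e x, hle ⟨x, hx, rfl⟩, e.symm_apply_apply x⟩
  have heq := hK.2 _ hK'c hle'
  refine le_antisymm (fun y hy => ?_) hle
  have : e.symm y ∈ K := by rw [← heq]; exact ⟨y, hy, rfl⟩
  exact ⟨e.symm y, this, e.apply_symm_apply y⟩

/-- **Remark 3.8.1** for the compatible reading: an isomorphism of topological groups is compatibly
quasi-geometric (`φ(K₁)`, `φ(H₁)` themselves are the distinct pair).
[cite: MochizukiSemiAnbd2006, Rmk 3.8.1 p.42] -/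
theorem IsCompatiblyQuasiGeometric.of_continuousMulEquiv (e : G₁ ≃ₜ* G₂) :
    IsCompatiblyQuasiGeometric (e : G₁ →ₜ* G₂) := by
  refine ⟨IsQuasiGeometric.of_continuousMulEquiv e, fun K₁ H₁ hK₁ hH₁ hne _ => ?_⟩
  have hmap : ∀ H : Subgroup G₁, H.map (e : G₁ →ₜ* G₂).toMonoidHom = H.map e.toMonoidHom :=
    fun H => rfl
  refine ⟨K₁.map e.toMonoidHom, H₁.map e.toMonoidHom, isMaximalCompactSubgroup_map' e hK₁,
    isMaximalCompactSubgroup_map' e hH₁, fun h => hne (Subgroup.map_injective e.injective h),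
    le_of_eq (hmap K₁), le_of_eq (hmap H₁)⟩

/-- The compatible reading implies the literal one. [cite: MochizukiSemiAnbd2006, Def 3.8 p.42] -/
theorem IsCompatiblyQuasiGeometric.toIsQuasiGeometric {φ : G₁ →ₜ* G₂}
    (h : IsCompatiblyQuasiGeometric φ) : IsQuasiGeometric φ := h.isQuasiGeometric

end Literature.AnabelianGeometry.SemiGraphs
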